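import Summits.AtomisticToContinuum.Crystallization.Theorems.OverbindingBudgetAffineRunCutUniax

/-!
# `OverbindingBudget` / crux `RobustDefectLimitWindows` (stmt-AtomisticToContinuum-31280) — «RunCut» part 25 «LAMINATE-α»:
# THE PLANIMETRY OF TWO SHEETS ABOUT A MOVER, AND THE LAMINATE ENGINE OF THE TIGHT BALL

Support file (lens-4 g92; order of record (2c), `ρ₁ = 30` FINAL-in-practice; booked crit r1644 (B1)–(B3); memo `g92/memo/LAMINATE-g92.md`;
architecture `g91/memo/UNIAX-g91.md` §3–§4, `g88/memo/PHIFF-g88.md` §3, `g87/memo/SW-CHI.md` §9.4).  The far-field line of the leaf reads a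
mover's tight ball `B(y i, R_t ν_i)` as a LAMINATE: the h-sheets (chart planes of chart-hcp sites) meeting it must not cross inside it, so that
their caps nest and the telescoping of PHIFF-g88 §1 changes complete layer discs only by in-plane offsets.  This part turns the typed interface
(U)(M)(E) of part 24 into that statement for every pair of sheets of DIFFERENT families (`|cos| ≤ 87/250`):
* §1 ★ `two_plane_offsets` — THE PLANIMETRY LEMMA (pure Euclidean; sharp two-offset form of TREE `…TwoPlane.two_plane_point` / 22D-α
  `two_plane_inplane`): unit normals at `|⟪n₁, n₂⟫| ≤ c < 1`, planes passing within `d₁ ν`, `d₂ ν` of `x`; the foot `z = x + α n₁ + β n₂` of the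
  meet line has `(1 − g²)‖z − x‖² = δ₁² + δ₂² − 2 g δ₁ δ₂`, hence `‖z − x‖ ≤ P ν` whenever `d₁² + d₂² + 2 c d₁ d₂ ≤ (1 − c²) P²`, and the
  IN-PLANE excursions `‖z − pᵢ‖ ≤ ‖x − pᵢ‖ + mᵢ ν` with `(d₂ + c d₁)² ≤ (1 − c²) m₁²`, `(d₁ + c d₂)² ≤ (1 − c²) m₂²` (what the walkers of (E) need:
  the excursion ALONG sheet 1 is driven by the offset of sheet 2, so a near-core sheet keeps the far walker short while the near walker starts
  close — the triangle inequality alone gives `20 + 20.1 = 40.1 ν_i > 35.83`, dead); `beyond_plane` — a point on the far side of a plane is at least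
  the offset away (the parent-separation glue of part 26).
* §2 ★★ `no_sheet_crossing` — THE LAMINATE ENGINE ABOUT A MOVER (section `Atlas`, `ρ₁ ≥ 30`, mover `i`: `dist(y i, y j) ≤ 5/2 ν_j`): two chart-hcp
  sites `a`, `b` within `20 ν_i` of the mover whose axes read `|⟪N_a, N_b⟫| ≤ 87/250` admit NO common point `z` of their chart planes with
  `dist(z, y i) ≤ 20.1 ν_i`, `‖z − y a‖ ≤ 35.4 ν_i`, `‖z − y b‖ ≤ 35.4 ν_i` — (M) `tight_site` (every site within `20 ν_i` of a mover is charted, within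
  `22.722 ν_j`, windowed `[0.936, 1.069] ν_j`), (M) `tight_ball` (`z` within `2.5 + 1.0111·20.1 = 22.823 ν_j`; `22.823 + 6.71·1.069 = 29.996 ≤ 30`),
  walker range `35.4 ν_i ≤ 35.4·1.0111 ν_j = 35.793 ν_j ≤ 957/25 · 0.936 ν_j = 35.830 ν_j`, and (E) `no_crossing_local`.  ★★ `sheets_laminar` — the
  record instance `R_t = 35/2`: two such sheets with sites in the tight ball have no common point in the tight ball (`35/2 + 35/2 = 35 ≤ 35.4`):
  SHEETS OF DIFFERENT FAMILIES DO NOT CROSS INSIDE THE TIGHT BALL — the laminate axiom of PHIFF-g88 §1/§3 (d) for such pairs, with NO hypothesis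
  on how the sheets are connected to the core (this answers the open design point of POINTERS-g92 §2 (a) for `|cos| ≤ 87/250`: foreign parallel
  families not h–h-connected to the core need no carry — the engine is pointwise).
* §3 ★ `offsets_exclusion` — §1 + §2 in offset form (plane offsets `d_a ν_i`, `d_b ν_i` from the mover, sources within `R_a ν_i`, `R_b ν_i`;
  numeric side conditions `d_a² + d_b² + 2c d_a d_b ≤ (1 − c²) P²`, `P ≤ 20.1`, `R + m ≤ 35.4`); ★★ `core_excludes_sheet` — with an h-site within
  `3 ν_i` of the mover, NO `1/3`-foreign sheet with a site within `20 ν_i` passes within `35/2 ν_i` of the mover (`9 + 306.25 + 36.54 = 351.79 ≤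
  0.878896·20.1² = 355.08`; excursions `m = 20, 10`), hence ★★ `core_polarises` — every h-site within `35/2 ν_i` reads `|cos| > 87/250` against
  it: ONE NEAR-CORE SHEET POLARISES THE WHOLE TIGHT BALL (`R_t = 17.5` is the record: `17.59` is the exact root, UNIAX-g91 §3);
  ★ `near_pair_polarised` — any two h-sites within `57/5 = 11.4 ν_i` of a mover read `|cos| > 87/250` (`350.37 ≤ 355.08`, `m = 82/5`), the
  leg-free complement of the hub's `10 ν_i` (23C-β `hub_uniaxial`).
NOT in this part (memo §4, part 26 «LAMINATE-β»): SHALLOW pairs `87/250 < |cos| < 0.99` (twin-of-twin families at `5/9`, `7/9`) — they are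
separated from the core by their parent twin plane, itself a `1/3`-sheet kept `> 35/2 ν_i` off the mover by `core_excludes_sheet`, and `beyond_plane` then puts them
outside `B(y i, 17.5 ν_i)`; the ORDER lemma that produces the parent is the minimal-counterexample carry of part 26.
[this file: 0 definitions; imports `…RunCutUniax` (part 24, tree) only; standard axioms]
-/

namespace Summit.AtomisticToContinuum.Crystallization.Theorems.OverbindingBudgetAffineRunCutLaminate

open scoped InnerProductSpace
open Literature.Geometry.DiscreteGeometry
open Summit.AtomisticToContinuum.Crystallization.Theorems.OverbindingBudgetAffineCompressedCutEstablish (nearestDist_pos_of_frame)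
open Summit.AtomisticToContinuum.Crystallization.Theorems.OverbindingBudgetAffineRunCutSheetNets (gram_identities norm_sq_smul_sub_axis
  lat_norm_le)
open Summit.AtomisticToContinuum.Crystallization.Theorems.OverbindingBudgetAffineRunCutSheetCrossing (unit_axis)
open Summit.AtomisticToContinuum.Crystallization.Theorems.OverbindingBudgetAffineRunCutUniax (pivot_window_thirty mover_window tight_ball
  no_crossing_local)

variable {N : ℕ}
local notation "E3" => EuclideanSpace ℝ (Fin 3)

/-! ## §1 The planimetry of two planes about a point -/

/-- Real glue: `(1 − g²) S = δ₁² + δ₂² − 2 g δ₁ δ₂`, `S ≥ 0`, `|g| ≤ c < 1`, `|δᵢ| ≤ dᵢ ν`, `d₁² + d₂² + 2 c d₁ d₂ ≤ (1 − c²) P²`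
⇒ `S ≤ (P ν)²`. [this file · kind: glue] -/
theorem offsets_norm_real {g c δ₁ δ₂ d₁ d₂ ν P S : ℝ} (hg : |g| ≤ c) (hc1 : c < 1) (hδ₁ : |δ₁| ≤ d₁ * ν) (hδ₂ : |δ₂| ≤ d₂ * ν)
    (hS0 : 0 ≤ S) (hkey : (1 - g ^ 2) * S = δ₁ ^ 2 + δ₂ ^ 2 - 2 * g * δ₁ * δ₂)
    (hP : d₁ ^ 2 + d₂ ^ 2 + 2 * c * d₁ * d₂ ≤ (1 - c ^ 2) * P ^ 2) : S ≤ (P * ν) ^ 2 := by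
  have hg0 : 0 ≤ |g| := abs_nonneg g
  have hc0 : 0 ≤ c := hg0.trans hg
  have hga : |g| ^ 2 = g ^ 2 := sq_abs g
  have hgc : g ^ 2 ≤ c ^ 2 := by rw [← hga]; exact pow_le_pow_left₀ hg0 hg 2
  have hcc : 0 < 1 - c ^ 2 := by nlinarith
  have h1 : δ₁ ^ 2 ≤ (d₁ * ν) ^ 2 := by rw [← sq_abs δ₁]; exact pow_le_pow_left₀ (abs_nonneg _) hδ₁ 2
  have h2 : δ₂ ^ 2 ≤ (d₂ * ν) ^ 2 := by rw [← sq_abs δ₂]; exact pow_le_pow_left₀ (abs_nonneg _) hδ₂ 2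
  have hcross : -(2 * g * δ₁ * δ₂) ≤ 2 * c * (d₁ * ν) * (d₂ * ν) := by
    have e1 : -(2 * g * δ₁ * δ₂) ≤ |2 * g * δ₁ * δ₂| := neg_le_abs _
    have e2 : |2 * g * δ₁ * δ₂| = 2 * |g| * (|δ₁| * |δ₂|) := by rw [abs_mul, abs_mul, abs_mul, abs_two]; ring
    have e3 : |δ₁| * |δ₂| ≤ d₁ * ν * (d₂ * ν) := mul_le_mul hδ₁ hδ₂ (abs_nonneg _) ((abs_nonneg _).trans hδ₁)
    have e4 : 2 * |g| * (|δ₁| * |δ₂|) ≤ 2 * c * (d₁ * ν * (d₂ * ν)) :=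
      mul_le_mul (by linarith) e3 (mul_nonneg (abs_nonneg _) (abs_nonneg _)) (by linarith)
    linarith
  have hR : δ₁ ^ 2 + δ₂ ^ 2 - 2 * g * δ₁ * δ₂ ≤ (1 - c ^ 2) * (P * ν) ^ 2 := by
    have := mul_le_mul_of_nonneg_right hP (sq_nonneg ν)
    nlinarith
  have hL : (1 - c ^ 2) * S ≤ (1 - g ^ 2) * S := mul_le_mul_of_nonneg_right (by linarith) hS0
  exact le_of_mul_le_mul_left (by linarith) hcc

/-- Real glue: `β (1 − g²) = g δ − δ'`, `|g| ≤ c < 1`, `|δ| ≤ d ν`, `|δ'| ≤ d' ν`, `(d' + c d)² ≤ (1 − c²) m²`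
⇒ `β² (1 − g²) ≤ (m ν)²` (the in-plane coefficient of the foot). [this file · kind: glue] -/
theorem offsets_coeff_real {g c δ δ' d d' ν m β : ℝ} (hg : |g| ≤ c) (hc1 : c < 1) (hδ : |δ| ≤ d * ν) (hδ' : |δ'| ≤ d' * ν)
    (hβ : β * (1 - g ^ 2) = g * δ - δ') (hm : (d' + c * d) ^ 2 ≤ (1 - c ^ 2) * m ^ 2) : β ^ 2 * (1 - g ^ 2) ≤ (m * ν) ^ 2 := by
  have hg0 : 0 ≤ |g| := abs_nonneg g
  have hc0 : 0 ≤ c := hg0.trans hg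
  have hga : |g| ^ 2 = g ^ 2 := sq_abs g
  have hgc : g ^ 2 ≤ c ^ 2 := by rw [← hga]; exact pow_le_pow_left₀ hg0 hg 2
  have hD : 0 < 1 - g ^ 2 := by nlinarith
  have hd0 : 0 ≤ d * ν := (abs_nonneg _).trans hδ
  have habs : |g * δ - δ'| ≤ (d' + c * d) * ν := by
    have e1 : |g * δ - δ'| ≤ |g * δ| + |δ'| := abs_sub _ _
    have e2 : |g * δ| = |g| * |δ| := abs_mul _ _
    have e3 : |g| * |δ| ≤ c * (d * ν) := mul_le_mul hg hδ (abs_nonneg _) hc0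
    nlinarith
  have hsq : (g * δ - δ') ^ 2 ≤ ((d' + c * d) * ν) ^ 2 := by
    rw [← sq_abs (g * δ - δ')]; exact pow_le_pow_left₀ (abs_nonneg _) habs 2
  have hkey : (β ^ 2 * (1 - g ^ 2)) * (1 - g ^ 2) = (g * δ - δ') ^ 2 := by rw [← hβ]; ring
  have hT : (β ^ 2 * (1 - g ^ 2)) * (1 - g ^ 2) ≤ (m * ν) ^ 2 * (1 - g ^ 2) := by
    rw [hkey]
    have := mul_le_mul_of_nonneg_right hm (sq_nonneg ν)
    nlinarith
  exact le_of_mul_le_mul_right hT hD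

/-- ★ **THE PLANIMETRY LEMMA** (two offsets, sharp `1 − c²`).  Unit normals `n₁`, `n₂` with `|⟪n₁, n₂⟫| ≤ c < 1`; the planes `⟪nᵢ, · − pᵢ⟫ = 0`
pass within `d₁ ν`, `d₂ ν` of `x` (`|⟪nᵢ, x − pᵢ⟫| ≤ dᵢ ν`, `ν ≥ 0`); numerals `P, m₁, m₂ ≥ 0` with `d₁² + d₂² + 2 c d₁ d₂ ≤ (1 − c²) P²`,
`(d₂ + c d₁)² ≤ (1 − c²) m₁²`, `(d₁ + c d₂)² ≤ (1 − c²) m₂²`.  Then the FOOT `z = x + α n₁ + β n₂` of the meet line (`α (1 − g²) = g δ₂ − δ₁`,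
`β (1 − g²) = g δ₁ − δ₂`, `g = ⟪n₁, n₂⟫`) lies on both planes with `‖z − x‖ ≤ P ν` (`(1 − g²)‖z − x‖² = δ₁² + δ₂² − 2 g δ₁ δ₂`) and
`‖z − p₁‖ ≤ ‖x − p₁‖ + m₁ ν`, `‖z − p₂‖ ≤ ‖x − p₂‖ + m₂ ν` (`z − p₁ = lat_{n₁}(x − p₁) + β (n₂ − g n₁)`, `‖β (n₂ − g n₁)‖² = β² (1 − g²)`).
Gram algebra of 22D-α `gram_identities`, `norm_sq_smul_sub_axis`. [this file · kind: proof] -/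
theorem two_plane_offsets {n₁ n₂ x p₁ p₂ : E3} {c d₁ d₂ ν P m₁ m₂ : ℝ} (h₁ : ‖n₁‖ = 1) (h₂ : ‖n₂‖ = 1) (hc : |⟪n₁, n₂⟫_ℝ| ≤ c)
    (hc1 : c < 1) (hν : 0 ≤ ν) (hd₁ : |⟪n₁, x - p₁⟫_ℝ| ≤ d₁ * ν) (hd₂ : |⟪n₂, x - p₂⟫_ℝ| ≤ d₂ * ν)
    (hP0 : 0 ≤ P) (hP : d₁ ^ 2 + d₂ ^ 2 + 2 * c * d₁ * d₂ ≤ (1 - c ^ 2) * P ^ 2)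
    (hm₁0 : 0 ≤ m₁) (hm₁ : (d₂ + c * d₁) ^ 2 ≤ (1 - c ^ 2) * m₁ ^ 2)
    (hm₂0 : 0 ≤ m₂) (hm₂ : (d₁ + c * d₂) ^ 2 ≤ (1 - c ^ 2) * m₂ ^ 2) :
    ∃ z : E3, ⟪n₁, z - p₁⟫_ℝ = 0 ∧ ⟪n₂, z - p₂⟫_ℝ = 0 ∧ ‖z - x‖ ≤ P * ν ∧
      ‖z - p₁‖ ≤ ‖x - p₁‖ + m₁ * ν ∧ ‖z - p₂‖ ≤ ‖x - p₂‖ + m₂ * ν := by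
  set g : ℝ := ⟪n₁, n₂⟫_ℝ with hg
  set δ₁ : ℝ := ⟪n₁, x - p₁⟫_ℝ with hδ₁
  set δ₂ : ℝ := ⟪n₂, x - p₂⟫_ℝ with hδ₂
  have hg1 : |g| < 1 := lt_of_le_of_lt hc hc1
  have hD : 0 < 1 - g ^ 2 := by nlinarith [abs_nonneg g, sq_abs g]
  obtain ⟨hsys₁, hsys₂, hbβ, haα, hkey⟩ := gram_identities g δ₁ δ₂ hD.ne'
  set a : ℝ := (g * δ₂ - δ₁) / (1 - g ^ 2) with ha
  set b : ℝ := (g * δ₁ - δ₂) / (1 - g ^ 2) with hb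
  have hn11 : ⟪n₁, n₁⟫_ℝ = 1 := by rw [real_inner_self_eq_norm_sq, h₁]; norm_num
  have hn22 : ⟪n₂, n₂⟫_ℝ = 1 := by rw [real_inner_self_eq_norm_sq, h₂]; norm_num
  have hn21 : ⟪n₂, n₁⟫_ℝ = g := by rw [hg, real_inner_comm]
  refine ⟨x + a • n₁ + b • n₂, ?_, ?_, ?_, ?_, ?_⟩
  · have hz : x + a • n₁ + b • n₂ - p₁ = (x - p₁) + a • n₁ + b • n₂ := by abel
    rw [hz, inner_add_right, inner_add_right, real_inner_smul_right, real_inner_smul_right, hn11, ← hg, ← hδ₁]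
    linear_combination hsys₁
  · have hz : x + a • n₁ + b • n₂ - p₂ = (x - p₂) + a • n₁ + b • n₂ := by abel
    rw [hz, inner_add_right, inner_add_right, real_inner_smul_right, real_inner_smul_right, hn21, hn22, ← hδ₂]
    linear_combination hsys₂
  · have hz : x + a • n₁ + b • n₂ - x = a • n₁ + b • n₂ := by abel
    have hsq : ‖a • n₁ + b • n₂‖ ^ 2 = a ^ 2 + b ^ 2 + 2 * a * b * g := by
      rw [← real_inner_self_eq_norm_sq]
      simp only [inner_add_left, inner_add_right, real_inner_smul_left, real_inner_smul_right, hn11, hn22, hn21, ← hg]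
      ring
    have hS : a ^ 2 + b ^ 2 + 2 * a * b * g ≤ (P * ν) ^ 2 :=
      offsets_norm_real hc hc1 hd₁ hd₂ (by rw [← hsq]; positivity) hkey hP
    rw [hz]; exact le_of_pow_le_pow_left₀ two_ne_zero (mul_nonneg hP0 hν) (by rw [hsq]; exact hS)
  · have ha' : a = -δ₁ - b * g := by linarith [hsys₁]
    have hz : x + a • n₁ + b • n₂ - p₁ = ((x - p₁) - δ₁ • n₁) + b • (n₂ - g • n₁) := by
      rw [ha', sub_smul, neg_smul, smul_sub, smul_smul]; abel
    have hB : ‖b • (n₂ - g • n₁)‖ ^ 2 ≤ (m₁ * ν) ^ 2 := by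
      rw [norm_sq_smul_sub_axis h₁ h₂ hg.symm b]; exact offsets_coeff_real hc hc1 hd₁ hd₂ hbβ hm₁
    have hB' : ‖b • (n₂ - g • n₁)‖ ≤ m₁ * ν := le_of_pow_le_pow_left₀ two_ne_zero (mul_nonneg hm₁0 hν) hB
    rw [hz]
    exact (norm_add_le _ _).trans (add_le_add (lat_norm_le h₁ (x - p₁)) hB')
  · have hb' : b = -δ₂ - a * g := by linarith [hsys₂]
    have hz : x + a • n₁ + b • n₂ - p₂ = ((x - p₂) - δ₂ • n₂) + a • (n₁ - g • n₂) := by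
      rw [hb', sub_smul, neg_smul, smul_sub, smul_smul]; abel
    have hc' : |⟪n₂, n₁⟫_ℝ| ≤ c := by rw [hn21]; exact hc
    have hA : ‖a • (n₁ - g • n₂)‖ ^ 2 ≤ (m₂ * ν) ^ 2 := by
      rw [norm_sq_smul_sub_axis h₂ h₁ hn21 a]; exact offsets_coeff_real hc hc1 hd₂ hd₁ haα hm₂
    have hA' : ‖a • (n₁ - g • n₂)‖ ≤ m₂ * ν := le_of_pow_le_pow_left₀ two_ne_zero (mul_nonneg hm₂0 hν) hA
    rw [hz]
    exact (norm_add_le _ _).trans (add_le_add (lat_norm_le h₂ (x - p₂)) hA')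

/-- ★ BEYOND A PLANE: `‖n‖ = 1`; if `x` and `z` lie (weakly) on opposite sides of the plane `⟪n, · − p⟫ = 0`
(`⟪n, x − p⟫ · ⟪n, z − p⟫ ≤ 0`), then `|⟪n, x − p⟫| ≤ dist z x`: the far side of a plane at offset `> R` from `x` misses `B(x, R)`
(the parent-separation glue of the laminate). [this file · kind: glue] -/
theorem beyond_plane {n x z p : E3} (hn : ‖n‖ = 1) (hside : ⟪n, x - p⟫_ℝ * ⟪n, z - p⟫_ℝ ≤ 0) : |⟪n, x - p⟫_ℝ| ≤ dist z x := by
  have e : ⟪n, x - p⟫_ℝ = ⟪n, x - z⟫_ℝ + ⟪n, z - p⟫_ℝ := by rw [← inner_add_right]; congr 1; abel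
  have h1 : |⟪n, x - z⟫_ℝ| ≤ dist z x := by
    rw [dist_comm, dist_eq_norm]
    simpa [hn] using abs_real_inner_le_norm n (x - z)
  have h2 : |⟪n, x - p⟫_ℝ| ≤ |⟪n, x - z⟫_ℝ| := by
    rw [abs_le]
    constructor
    · nlinarith [abs_nonneg ⟪n, x - z⟫_ℝ, neg_abs_le ⟪n, x - z⟫_ℝ, le_abs_self ⟪n, x - z⟫_ℝ, sq_nonneg ⟪n, z - p⟫_ℝ]
    · nlinarith [abs_nonneg ⟪n, x - z⟫_ℝ, neg_abs_le ⟪n, x - z⟫_ℝ, le_abs_self ⟪n, x - z⟫_ℝ, sq_nonneg ⟪n, z - p⟫_ℝ]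
  exact h2.trans h1

section Atlas
/-! ONE chart datum on the ball `B(y j, ρ₁ ν_j)` (verbatim §2 of part 22A). -/
variable {y : Fin N → E3} (hy : Function.Injective y) {j : Fin N} {ρ₁ : ℝ}
  {Ac : Fin N → (E3 →ₗ[ℝ] E3)} {Qc : Fin N → (E3 →ₗᵢ[ℝ] E3)} {Pc : Fin N → Finset E3} {fc : Fin N → E3 → E3}
  (hP : ∀ i, dist (y i) (y j) ≤ ρ₁ * nearestDist y j → Pc i = fccTwoShellPattern ∨ Pc i = hcpTwoShellPattern)
  (hA : ∀ i, dist (y i) (y j) ≤ ρ₁ * nearestDist y j → ∀ v ∈ Pc i, ‖Ac i v - Qc i v‖ ≤ 1 / 1000)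
  (hf : ∀ i, dist (y i) (y j) ≤ ρ₁ * nearestDist y j → ∀ v ∈ Pc i,
    fc i v ∈ Set.range y ∧ dist (fc i v) (y i + nearestDist y i • Ac i v) ≤ 1 / 10 ^ 4 * nearestDist y i)
  (hinj : ∀ i, dist (y i) (y j) ≤ ρ₁ * nearestDist y j → Set.InjOn (fc i) ↑(Pc i))
  (hex : ∀ i, dist (y i) (y j) ≤ ρ₁ * nearestDist y j → ∀ k : Fin N, k ≠ i →
    dist (y k) (y i) ≤ (3 / 2 + 1 / 450) * nearestDist y i → ∃ v ∈ Pc i, fc i v = y k)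

include hy hP hA hf hinj hex

/-! ## §2 The laminate engine about a mover -/

/-- (M) A SITE OF THE WIDE TIGHT BALL: `ρ₁ ≥ 30`, mover `i`, `dist(y m, y i) ≤ R ν_i` with `0 ≤ R ≤ 20`: `m` lies within `(5/2 + 1.0111 R) ν_j ≤ 22.722 ν_j`
of the pivot, is charted, and `0.936 ν_j ≤ ν_m ≤ 1.069 ν_j` (part 24 `tight_ball`, `pivot_window_thirty`). [this file · kind: glue] -/
theorem tight_site (hρ : 30 ≤ ρ₁) {i : Fin N} (hi : dist (y i) (y j) ≤ 5 / 2 * nearestDist y j) {m : Fin N} {R : ℝ} (hR0 : 0 ≤ R)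
    (hR : R ≤ 20) (hm : dist (y m) (y i) ≤ R * nearestDist y i) :
    dist (y m) (y j) ≤ (5 / 2 + 10111 / 10000 * R) * nearestDist y j ∧ dist (y m) (y j) ≤ ρ₁ * nearestDist y j ∧
      936 / 1000 * nearestDist y j ≤ nearestDist y m ∧ nearestDist y m ≤ 1069 / 1000 * nearestDist y j := by
  have hν0 : 0 ≤ nearestDist y j := nearestDist_nonneg _ _
  have h1 := tight_ball hy hP hA hf hinj hex (by linarith) hi hR0 hm
  have h24 : dist (y m) (y j) ≤ 24 * nearestDist y j := by
    have := mul_le_mul_of_nonneg_right (show 5 / 2 + 10111 / 10000 * R ≤ (24 : ℝ) by linarith) hν0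
    linarith
  exact ⟨h1, pivot_window_thirty hy hP hA hf hinj hex hρ h24⟩

/-- ★★ **THE LAMINATE ENGINE ABOUT A MOVER.**  `ρ₁ ≥ 30`; mover `i` (`dist(y i, y j) ≤ 5/2 ν_j`); chart-hcp sites `a`, `b` within `20 ν_i` of
`y i` whose unit frame axes read `|⟪N_a, N_b⟫| ≤ 87/250`.  Then NO point `z` lies on both chart planes (`⟪N_a, z − y a⟫ = 0 = ⟪N_b, z − y b⟫`)
with `dist(z, y i) ≤ 201/10 ν_i`, `‖z − y a‖ ≤ 177/5 ν_i`, `‖z − y b‖ ≤ 177/5 ν_i`.  (E) `no_crossing_local` at `(lo, hi, c, Z) = (0.936, 1.069,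
87/250, 2.5 + 1.0111·20.1 = 22.82311)`: `Z + 6.71·1.069 = 29.9961 ≤ 30`; sites within `22.722 ν_j ≤ Z` and windowed by `tight_site`; walker
range `177/5 ν_i ≤ 177/5 · 1.0111 ν_j = 35.793 ν_j ≤ 957/25 · 0.936 ν_j = 35.830 ν_j ≤ 957/25 ν_a`. [this file · kind: proof] -/
theorem no_sheet_crossing (hρ : 30 ≤ ρ₁) {i : Fin N} (hi : dist (y i) (y j) ≤ 5 / 2 * nearestDist y j) {a b : Fin N}
    (hPa : Pc a = hcpTwoShellPattern) (hPb : Pc b = hcpTwoShellPattern)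
    (ha : dist (y a) (y i) ≤ 20 * nearestDist y i) (hb : dist (y b) (y i) ≤ 20 * nearestDist y i) {na nb : E3}
    (hna : na = (‖Ac a ((Real.sqrt 18)⁻¹ • intVec ![4, 4, 4])‖⁻¹ • Ac a ((Real.sqrt 18)⁻¹ • intVec ![4, 4, 4]) : E3))
    (hnb : nb = (‖Ac b ((Real.sqrt 18)⁻¹ • intVec ![4, 4, 4])‖⁻¹ • Ac b ((Real.sqrt 18)⁻¹ • intVec ![4, 4, 4]) : E3))
    (hc : |⟪na, nb⟫_ℝ| ≤ 87 / 250) {z : E3} (hz1 : ⟪na, z - y a⟫_ℝ = 0) (hz2 : ⟪nb, z - y b⟫_ℝ = 0)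
    (hzi : dist z (y i) ≤ 201 / 10 * nearestDist y i) (hza : ‖z - y a‖ ≤ 177 / 5 * nearestDist y i)
    (hzb : ‖z - y b‖ ≤ 177 / 5 * nearestDist y i) : False := by
  have hν0 : 0 ≤ nearestDist y j := nearestDist_nonneg _ _
  have hj0 : dist (y j) (y j) ≤ ρ₁ * nearestDist y j := by rw [dist_self]; nlinarith
  have hνj : 0 < nearestDist y j := nearestDist_pos_of_frame hy (hP _ hj0) (fun v hv => (hf _ hj0 v hv).1) (hinj _ hj0)
  obtain ⟨-, -, hνi⟩ := mover_window hy hP hA hf hinj hex (by linarith) hi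
  obtain ⟨hDa, hballa, hloa, hhia⟩ := tight_site hy hP hA hf hinj hex hρ hi (by norm_num) le_rfl ha
  obtain ⟨hDb, hballb, hlob, hhib⟩ := tight_site hy hP hA hf hinj hex hρ hi (by norm_num) le_rfl hb
  have hZz := tight_ball hy hP hA hf hinj hex (by linarith) hi (by norm_num) hzi
  -- walker ranges in the source sites' own scales
  have hΛ : 177 / 5 * nearestDist y i ≤ 957 / 25 * (936 / 1000 * nearestDist y j) := by nlinarith
  have hΛa : ‖z - y a‖ ≤ 957 / 25 * nearestDist y a := by nlinarith
  have hΛb : ‖z - y b‖ ≤ 957 / 25 * nearestDist y b := by nlinarith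
  have hZa : dist (y a) (y j) ≤ (5 / 2 + 10111 / 10000 * (201 / 10)) * nearestDist y j := by nlinarith
  have hZb : dist (y b) (y j) ≤ (5 / 2 + 10111 / 10000 * (201 / 10)) * nearestDist y j := by nlinarith
  exact no_crossing_local hy hP hA hf hinj hex hballa hPa hballb hPb hνj hna hnb (lo := 936 / 1000) (hi := 1069 / 1000)
    (Z := 5 / 2 + 10111 / 10000 * (201 / 10)) hc le_rfl hloa hhia hlob hhib (by norm_num) hz1 hz2 hΛa hΛb hZa hZb hZz
    (by norm_num at hρ ⊢; linarith)

/-- ★★ **SHEETS OF DIFFERENT FAMILIES DO NOT CROSS INSIDE THE TIGHT BALL** (record instance `R_t = 35/2`).  `ρ₁ ≥ 30`, mover `i`; two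
chart-hcp sites `a`, `b` of the tight ball `B(y i, 35/2 ν_i)` whose axes read `|⟪N_a, N_b⟫| ≤ 87/250`: their chart planes have NO common point
in the tight ball (`‖z − y a‖ ≤ 35/2 + 35/2 = 35 ≤ 177/5`).  No hypothesis relates `a`, `b` to the core: the laminate axiom of PHIFF-g88 §1 for
such pairs, pointwise. [this file · kind: proof] -/
theorem sheets_laminar (hρ : 30 ≤ ρ₁) {i : Fin N} (hi : dist (y i) (y j) ≤ 5 / 2 * nearestDist y j) {a b : Fin N}
    (hPa : Pc a = hcpTwoShellPattern) (hPb : Pc b = hcpTwoShellPattern)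
    (ha : dist (y a) (y i) ≤ 35 / 2 * nearestDist y i) (hb : dist (y b) (y i) ≤ 35 / 2 * nearestDist y i) {na nb : E3}
    (hna : na = (‖Ac a ((Real.sqrt 18)⁻¹ • intVec ![4, 4, 4])‖⁻¹ • Ac a ((Real.sqrt 18)⁻¹ • intVec ![4, 4, 4]) : E3))
    (hnb : nb = (‖Ac b ((Real.sqrt 18)⁻¹ • intVec ![4, 4, 4])‖⁻¹ • Ac b ((Real.sqrt 18)⁻¹ • intVec ![4, 4, 4]) : E3))
    (hc : |⟪na, nb⟫_ℝ| ≤ 87 / 250) {z : E3} (hz1 : ⟪na, z - y a⟫_ℝ = 0) (hz2 : ⟪nb, z - y b⟫_ℝ = 0)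
    (hzi : dist z (y i) ≤ 35 / 2 * nearestDist y i) : False := by
  have hν : 0 ≤ nearestDist y i := nearestDist_nonneg _ _
  have hza : ‖z - y a‖ ≤ 177 / 5 * nearestDist y i := by
    rw [← dist_eq_norm]; linarith [dist_triangle z (y i) (y a), dist_comm (y a) (y i)]
  have hzb : ‖z - y b‖ ≤ 177 / 5 * nearestDist y i := by
    rw [← dist_eq_norm]; linarith [dist_triangle z (y i) (y b), dist_comm (y b) (y i)]
  exact no_sheet_crossing hy hP hA hf hinj hex hρ hi hPa hPb (by linarith) (by linarith) hna hnb hc hz1 hz2 (by linarith) hza hzb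

/-! ## §3 Polarisation: offsets and the two record instances -/

/-- ★ **OFFSET FORM** (§1 + §2).  `ρ₁ ≥ 30`, mover `i`; chart-hcp sites `a`, `b` with `dist(y a, y i) ≤ R_a ν_i`, `dist(y b, y i) ≤ R_b ν_i`
(`R ≤ 20`), axes `|⟪N_a, N_b⟫| ≤ 87/250`, chart planes passing within `d_a ν_i`, `d_b ν_i` of the mover; numerals `P, m_a, m_b ≥ 0` with
`d_a² + d_b² + 2 (87/250) d_a d_b ≤ (1 − (87/250)²) P²`, `P ≤ 201/10`, `(d_b + (87/250) d_a)² ≤ (1 − (87/250)²) m_a²`, `R_a + m_a ≤ 177/5`, and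
symmetrically for `b`: contradiction (the foot of `two_plane_offsets` is a common point that `no_sheet_crossing` forbids). [this file · kind: proof] -/
theorem offsets_exclusion (hρ : 30 ≤ ρ₁) {i : Fin N} (hi : dist (y i) (y j) ≤ 5 / 2 * nearestDist y j) {a b : Fin N}
    (hPa : Pc a = hcpTwoShellPattern) (hPb : Pc b = hcpTwoShellPattern) {Ra Rb : ℝ}
    (ha : dist (y a) (y i) ≤ Ra * nearestDist y i) (hb : dist (y b) (y i) ≤ Rb * nearestDist y i) (hRa : Ra ≤ 20) (hRb : Rb ≤ 20)
    {na nb : E3} (hna : na = (‖Ac a ((Real.sqrt 18)⁻¹ • intVec ![4, 4, 4])‖⁻¹ • Ac a ((Real.sqrt 18)⁻¹ • intVec ![4, 4, 4]) : E3))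
    (hnb : nb = (‖Ac b ((Real.sqrt 18)⁻¹ • intVec ![4, 4, 4])‖⁻¹ • Ac b ((Real.sqrt 18)⁻¹ • intVec ![4, 4, 4]) : E3))
    (hc : |⟪na, nb⟫_ℝ| ≤ 87 / 250) {da db : ℝ} (hda : |⟪na, y i - y a⟫_ℝ| ≤ da * nearestDist y i)
    (hdb : |⟪nb, y i - y b⟫_ℝ| ≤ db * nearestDist y i) {P ma mb : ℝ} (hP0 : 0 ≤ P) (hP1 : P ≤ 201 / 10)
    (hPd : da ^ 2 + db ^ 2 + 2 * (87 / 250) * da * db ≤ (1 - (87 / 250) ^ 2) * P ^ 2)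
    (hma0 : 0 ≤ ma) (hma : (db + 87 / 250 * da) ^ 2 ≤ (1 - (87 / 250) ^ 2) * ma ^ 2) (hwa : Ra + ma ≤ 177 / 5)
    (hmb0 : 0 ≤ mb) (hmb : (da + 87 / 250 * db) ^ 2 ≤ (1 - (87 / 250) ^ 2) * mb ^ 2) (hwb : Rb + mb ≤ 177 / 5) : False := by
  have hν : 0 ≤ nearestDist y i := nearestDist_nonneg _ _
  have ha20 : dist (y a) (y i) ≤ 20 * nearestDist y i := ha.trans (mul_le_mul_of_nonneg_right hRa hν)
  have hb20 : dist (y b) (y i) ≤ 20 * nearestDist y i := hb.trans (mul_le_mul_of_nonneg_right hRb hν)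
  obtain ⟨-, hballa, -, -⟩ := tight_site hy hP hA hf hinj hex hρ hi (by norm_num) le_rfl ha20
  obtain ⟨-, hballb, -, -⟩ := tight_site hy hP hA hf hinj hex hρ hi (by norm_num) le_rfl hb20
  obtain ⟨h₁, -⟩ := unit_axis hy hA hf hinj hex hballa hPa
  obtain ⟨h₂, -⟩ := unit_axis hy hA hf hinj hex hballb hPb
  rw [← hna] at h₁
  rw [← hnb] at h₂
  obtain ⟨z, hz1, hz2, hzi, hza, hzb⟩ :=
    two_plane_offsets h₁ h₂ hc (by norm_num) hν hda hdb hP0 hPd hma0 hma hmb0 hmb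
  have hzi' : dist z (y i) ≤ 201 / 10 * nearestDist y i := by
    rw [dist_eq_norm]; exact hzi.trans (mul_le_mul_of_nonneg_right hP1 hν)
  have hea : ‖y i - y a‖ = dist (y a) (y i) := by rw [dist_comm, dist_eq_norm]
  have heb : ‖y i - y b‖ = dist (y b) (y i) := by rw [dist_comm, dist_eq_norm]
  have hza' : ‖z - y a‖ ≤ 177 / 5 * nearestDist y i := by
    have := mul_le_mul_of_nonneg_right hwa hν
    linarith
  have hzb' : ‖z - y b‖ ≤ 177 / 5 * nearestDist y i := by
    have := mul_le_mul_of_nonneg_right hwb hν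
    linarith
  exact no_sheet_crossing hy hP hA hf hinj hex hρ hi hPa hPb ha20 hb20 hna hnb hc hz1 hz2 hzi' hza' hzb'

/-- ★★ **A NEAR-CORE SHEET EXCLUDES EVERY FOREIGN SHEET FROM THE TIGHT BALL** (plane level).  `ρ₁ ≥ 30`, mover `i`; a chart-hcp site `a`
within `3 ν_i` of the mover, a chart-hcp site `b` within `R_b ν_i`, `R_b ≤ 20`, whose axes read `|⟪N_a, N_b⟫| ≤ 87/250`: the chart plane of `b`
does NOT pass within `35/2 ν_i` of the mover (`P = 201/10`: `9 + 1225/4 + 2·(87/250)·3·(35/2) = 351.79 ≤ 355.083`; `m_a = 20`: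
`(35/2 + 1.044)² = 343.88 ≤ 351.56`, `3 + 20 ≤ 35.4`; `m_b = 10`: `(3 + 6.09)² = 82.63 ≤ 87.89`, `20 + 10 ≤ 35.4`).  With `beyond_plane`: the far
side of such a sheet misses `B(y i, 35/2 ν_i)` — the parent-separation input of part 26. [this file · kind: proof] -/
theorem core_excludes_sheet (hρ : 30 ≤ ρ₁) {i : Fin N} (hi : dist (y i) (y j) ≤ 5 / 2 * nearestDist y j) {a b : Fin N}
    (hPa : Pc a = hcpTwoShellPattern) (hPb : Pc b = hcpTwoShellPattern) (ha : dist (y a) (y i) ≤ 3 * nearestDist y i) {Rb : ℝ}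
    (hb : dist (y b) (y i) ≤ Rb * nearestDist y i) (hRb : Rb ≤ 20) {na nb : E3}
    (hna : na = (‖Ac a ((Real.sqrt 18)⁻¹ • intVec ![4, 4, 4])‖⁻¹ • Ac a ((Real.sqrt 18)⁻¹ • intVec ![4, 4, 4]) : E3))
    (hnb : nb = (‖Ac b ((Real.sqrt 18)⁻¹ • intVec ![4, 4, 4])‖⁻¹ • Ac b ((Real.sqrt 18)⁻¹ • intVec ![4, 4, 4]) : E3))
    (hc : |⟪na, nb⟫_ℝ| ≤ 87 / 250) (hdb : |⟪nb, y i - y b⟫_ℝ| ≤ 35 / 2 * nearestDist y i) : False := by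
  obtain ⟨-, hballa, -, -⟩ := tight_site hy hP hA hf hinj hex hρ hi (by norm_num) (by norm_num) ha
  obtain ⟨h₁, -⟩ := unit_axis hy hA hf hinj hex hballa hPa
  rw [← hna] at h₁
  have hda : |⟪na, y i - y a⟫_ℝ| ≤ 3 * nearestDist y i := by
    refine (abs_real_inner_le_norm _ _).trans ?_
    rw [h₁, one_mul, ← dist_eq_norm, dist_comm]; exact ha
  have hnum : (3 : ℝ) ^ 2 + (35 / 2) ^ 2 + 2 * (87 / 250) * 3 * (35 / 2) ≤ (1 - (87 / 250) ^ 2) * (201 / 10) ^ 2 ∧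
      ((35 / 2 : ℝ) + 87 / 250 * 3) ^ 2 ≤ (1 - (87 / 250) ^ 2) * 20 ^ 2 ∧
      ((3 : ℝ) + 87 / 250 * (35 / 2)) ^ 2 ≤ (1 - (87 / 250) ^ 2) * 10 ^ 2 := by norm_num
  exact offsets_exclusion hy hP hA hf hinj hex hρ hi hPa hPb ha hb (by norm_num) hRb hna hnb hc hda hdb (P := 201 / 10) (ma := 20)
    (mb := 10) (by norm_num) le_rfl hnum.1 (by norm_num) hnum.2.1 (by norm_num) (by norm_num) hnum.2.2 (by linarith)

/-- ★★ **ONE NEAR-CORE SHEET POLARISES THE TIGHT BALL** (site level, record `R_t = 35/2`).  `ρ₁ ≥ 30`, mover `i`; a chart-hcp site `a` within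
`3 ν_i` of the mover and ANY chart-hcp site `b` within `35/2 ν_i`: their axes read `|⟪N_a, N_b⟫| > 87/250` (offset `≤` distance, then
`core_excludes_sheet`; `17.59` is the exact root, UNIAX-g91 §3).  With a core h-site within `3 ν_i`, every h-sheet with a site in
`B(y i, 17.5 ν_i)` is near-parallel or SHALLOW to it — no `1/3`-foreign family enters the tight ball, h–h-connected to the core or not.
[this file · kind: proof] -/
theorem core_polarises (hρ : 30 ≤ ρ₁) {i : Fin N} (hi : dist (y i) (y j) ≤ 5 / 2 * nearestDist y j) {a b : Fin N}
    (hPa : Pc a = hcpTwoShellPattern) (hPb : Pc b = hcpTwoShellPattern)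
    (ha : dist (y a) (y i) ≤ 3 * nearestDist y i) (hb : dist (y b) (y i) ≤ 35 / 2 * nearestDist y i) {na nb : E3}
    (hna : na = (‖Ac a ((Real.sqrt 18)⁻¹ • intVec ![4, 4, 4])‖⁻¹ • Ac a ((Real.sqrt 18)⁻¹ • intVec ![4, 4, 4]) : E3))
    (hnb : nb = (‖Ac b ((Real.sqrt 18)⁻¹ • intVec ![4, 4, 4])‖⁻¹ • Ac b ((Real.sqrt 18)⁻¹ • intVec ![4, 4, 4]) : E3)) :
    87 / 250 < |⟪na, nb⟫_ℝ| := by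
  by_contra hc
  rw [not_lt] at hc
  obtain ⟨-, hballb, -, -⟩ := tight_site hy hP hA hf hinj hex hρ hi (by norm_num) (by norm_num) hb
  obtain ⟨h₂, -⟩ := unit_axis hy hA hf hinj hex hballb hPb
  rw [← hnb] at h₂
  have hdb : |⟪nb, y i - y b⟫_ℝ| ≤ 35 / 2 * nearestDist y i := by
    refine (abs_real_inner_le_norm _ _).trans ?_
    rw [h₂, one_mul, ← dist_eq_norm, dist_comm]; exact hb
  exact core_excludes_sheet hy hP hA hf hinj hex hρ hi hPa hPb ha hb (by norm_num) hna hnb hc hdb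

/-- ★ **NEAR PAIRS ARE POLARISED.**  `ρ₁ ≥ 30`, mover `i`; any two chart-hcp sites within `57/5 = 11.4 ν_i` of the mover read
`|⟪N_a, N_b⟫| > 87/250` (`P = 201/10`: `2·129.96 + 2·(87/250)·129.96 = 350.37 ≤ 355.083`; `m = 82/5`: `(11.4·1.348)² = 236.15 ≤ 236.39`;
`11.4 + 16.4 ≤ 35.4`) — the leg-free form of the hub's uniaxiality (23C-β), radius `11.4` in place of `10`. [this file · kind: proof] -/
theorem near_pair_polarised (hρ : 30 ≤ ρ₁) {i : Fin N} (hi : dist (y i) (y j) ≤ 5 / 2 * nearestDist y j) {a b : Fin N}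
    (hPa : Pc a = hcpTwoShellPattern) (hPb : Pc b = hcpTwoShellPattern)
    (ha : dist (y a) (y i) ≤ 57 / 5 * nearestDist y i) (hb : dist (y b) (y i) ≤ 57 / 5 * nearestDist y i) {na nb : E3}
    (hna : na = (‖Ac a ((Real.sqrt 18)⁻¹ • intVec ![4, 4, 4])‖⁻¹ • Ac a ((Real.sqrt 18)⁻¹ • intVec ![4, 4, 4]) : E3))
    (hnb : nb = (‖Ac b ((Real.sqrt 18)⁻¹ • intVec ![4, 4, 4])‖⁻¹ • Ac b ((Real.sqrt 18)⁻¹ • intVec ![4, 4, 4]) : E3)) :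
    87 / 250 < |⟪na, nb⟫_ℝ| := by
  by_contra hc
  rw [not_lt] at hc
  obtain ⟨-, hballa, -, -⟩ := tight_site hy hP hA hf hinj hex hρ hi (by norm_num) (by norm_num) ha
  obtain ⟨-, hballb, -, -⟩ := tight_site hy hP hA hf hinj hex hρ hi (by norm_num) (by norm_num) hb
  obtain ⟨h₁, -⟩ := unit_axis hy hA hf hinj hex hballa hPa
  obtain ⟨h₂, -⟩ := unit_axis hy hA hf hinj hex hballb hPb
  rw [← hna] at h₁
  rw [← hnb] at h₂
  have hda : |⟪na, y i - y a⟫_ℝ| ≤ 57 / 5 * nearestDist y i := by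
    refine (abs_real_inner_le_norm _ _).trans ?_
    rw [h₁, one_mul, ← dist_eq_norm, dist_comm]; exact ha
  have hdb : |⟪nb, y i - y b⟫_ℝ| ≤ 57 / 5 * nearestDist y i := by
    refine (abs_real_inner_le_norm _ _).trans ?_
    rw [h₂, one_mul, ← dist_eq_norm, dist_comm]; exact hb
  have hnum : (57 / 5 : ℝ) ^ 2 + (57 / 5) ^ 2 + 2 * (87 / 250) * (57 / 5) * (57 / 5) ≤ (1 - (87 / 250) ^ 2) * (201 / 10) ^ 2 ∧
      ((57 / 5 : ℝ) + 87 / 250 * (57 / 5)) ^ 2 ≤ (1 - (87 / 250) ^ 2) * (82 / 5) ^ 2 := by norm_num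
  exact offsets_exclusion hy hP hA hf hinj hex hρ hi hPa hPb ha hb (by norm_num) (by norm_num) hna hnb hc hda hdb (P := 201 / 10)
    (ma := 82 / 5) (mb := 82 / 5) (by norm_num) le_rfl hnum.1 (by norm_num) hnum.2 (by norm_num) (by norm_num) hnum.2 (by norm_num)

end Atlas

end Summit.AtomisticToContinuum.Crystallization.Theorems.OverbindingBudgetAffineRunCutLaminate
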